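import Summits.QuantumFields.YangMills.Theorems.VirialFluxGapRadialProfile
import HarnessLib

/-!
# Route `VirialFluxGap` (YangMills): the FIRST VARIATION of the commutator norm under the radial profile — `δ‖[a,b]‖² = 2(c_a·Re a + c_b·Re b)·‖[a,b]‖²`

Brick (C1-ii) of the central charts for ⟨stmt-QuantumFields-24141⟩ (LEAD design notes №2∕№4): on CONSTANT ring histories the zero-flux deficit
is a sum of commutator norms `‖ab − ba‖²` of unit quaternions (✓`ConstantHistory.ringDeficit_const_eq_commutator_quartic`), and the zero-mode
block field ✓`CentralZeroModeField` moves each variable `a` with the RADIAL TANGENT `c_a · a·Im a = c_a(Re a·Im a − |Im a|²)` (✓`RadialProfile`: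
the frame derivative of the quaternion of a variable along `(v, quatMatrix p)` is `q_v·p`).  The first variation of one commutator term is then
EXACTLY proportional to the term itself:

* `comm_radial` — `[a·Im a, b] = Re a · [a, b]` and `[a, b·Im b] = Re b · [a, b]` (the scalar part drops out of commutators);
* ★★ `comm_first_variation` — `2⟨[a,b], c_a[a·Im a, b] + c_b[a, b·Im b]⟩ = 2(c_a Re a + c_b Re b)·‖[a,b]‖²` (componentwise inner product);
hence on the constant-history cone the zero-mode field reproduces the quartic with the factor `(σ_B Re q_B + σ_{B′} Re q_{B′})/2` per pair of
blocks — `= 1` at the central toron, relative defect `O(|z|²)` on the central ball (to be booked into `ε`).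

HONEST FRAMING: quaternion algebra only; no chart inequality is proved; ⟨24141⟩ stays OPEN; the Yang–Mills mass gap is NOT proved; no summit is
proved by a line.  THEOREMS ONLY (0 `def`, 0 `sorry`), standard axioms.  Width seat `ym-line-sfw-p2-w3` g58 (cell ym-idea-1, free hands),
`--supports stmt-QuantumFields-24141`.  References: [cite: CosteEtAl1985]; [cite: Luscher1983, §2].
-/

set_option autoImplicit false

noncomputable section

open scoped Quaternion

namespace Summit.QuantumFields.YangMills.Theorems.VirialFluxGap.FrameDerivative

/-- The radial tangent commutes like the element itself, up to the real part: `(a·Im a)·b − b·(a·Im a) = Re a · (ab − ba)`. [folklore] -/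
theorem comm_radial_left (a b : ℍ) : a * a.im * b - b * (a * a.im) = (a.re : ℍ) * (a * b - b * a) := by
  ext <;> simp [Quaternion.im] <;> ring

/-- The same on the right factor: `a·(b·Im b) − (b·Im b)·a = Re b · (ab − ba)`. [folklore] -/
theorem comm_radial_right (a b : ℍ) : a * (b * b.im) - b * b.im * a = (b.re : ℍ) * (a * b - b * a) := by
  ext <;> simp [Quaternion.im] <;> ring

/-- ★★ **First variation of the commutator norm under the radial profile**: with the componentwise inner product,
`2⟨[a,b], c_a·[a·Im a, b] + c_b·[a, b·Im b]⟩ = 2(c_a·Re a + c_b·Re b)·‖[a,b]‖²` (`‖·‖² = normSq`). [cite: CosteEtAl1985] -/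
theorem comm_first_variation (a b : ℍ) (ca cb : ℝ) :
    2 * ((a * b - b * a).re * (ca • (a * a.im * b - b * (a * a.im)) + cb • (a * (b * b.im) - b * b.im * a)).re +
        (a * b - b * a).imI * (ca • (a * a.im * b - b * (a * a.im)) + cb • (a * (b * b.im) - b * b.im * a)).imI +
        (a * b - b * a).imJ * (ca • (a * a.im * b - b * (a * a.im)) + cb • (a * (b * b.im) - b * b.im * a)).imJ +
        (a * b - b * a).imK * (ca • (a * a.im * b - b * (a * a.im)) + cb • (a * (b * b.im) - b * b.im * a)).imK) =
      2 * (ca * a.re + cb * b.re) * Quaternion.normSq (a * b - b * a) := by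
  rw [comm_radial_left, comm_radial_right, Quaternion.normSq_def']
  simp only [Quaternion.re_add, Quaternion.imI_add, Quaternion.imJ_add, Quaternion.imK_add, Quaternion.re_smul, Quaternion.imI_smul,
    Quaternion.imJ_smul, Quaternion.imK_smul, Quaternion.re_mul, Quaternion.imI_mul, Quaternion.imJ_mul, Quaternion.imK_mul,
    Quaternion.re_coe, Quaternion.imI_coe, Quaternion.imJ_coe, Quaternion.imK_coe, smul_eq_mul]
  ring

end Summit.QuantumFields.YangMills.Theorems.VirialFluxGap.FrameDerivative

end
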